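/-
Copyright (c) 2026. All rights reserved.
Released under Apache 2.0 license as described in the file LICENSE.
Authors: HodgeCM publication cell (pub-hodgecm), GR lane, seat own-crow (`pub-hodgecm-own-crow`), on GR-1's `Prop311PrintedL2OfRecord`.
-/
import Literature.NumberTheory.GelbartRogawski1991.Prop311PrintedL2OfRecord
import Literature.NumberTheory.GelbartRogawski1991.Prop311RecordShapesHold
import HarnessLib

-- buildfix G11b-3 recipe (LEDGER B13-1/B13-3): elaborate sequentially (dependent telescopes of the dual-pair datum).
set_option Elab.async false

/-!
# [GelbartRogawski1991, Prop. 3.1.1] AS PRINTED for the `L²(𝐀_Fⁿ)` model over an ARBITRARY quadratic `E/F` — UNCONDITIONAL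

Topic `NumberTheory/GelbartRogawski1991`; namespace `Literature.NumberTheory.GelbartRogawski1991.Prop311` (sequel of
`Prop311PrintedL2OfRecord` and `Prop311RecordShapesHold`).  KERNEL ONLY: one theorem; no definition, no named fact, no
instance attribute; nothing of [GelbartRogawski1991] or [Weil1964] asserted beyond what the tree proves.

`Prop311PrintedL2OfRecord.prop311_L2_of_record` (seat GR-1, «END modulo the record») proved the body of the printed
[GelbartRogawski1991, Prop. 3.1.1] for the CONCRETE Schrödinger model `ρ = l2Model` on `L²(𝐀_Fⁿ, ν)` over an arbitrary
quadratic extension `E/F`, from ONE hypothesis: `hrec : (pairLineDatum F E σ hσδ hδ hd f e hT).CompatibleSplitting`, a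
continuous compatible splitting of the tree's dual-pair datum with line second factor — the deliverable of the general
doubling construction.  That deliverable is now the tree theorem `Prop311.compatibleSplitting_pairLineDatum`
(`Prop311RecordShapesHold`, from GR-1's archimedean half `GRConstructionGen.exists_isArchHalf_diagonal`), and the
invertibility witness `hT` of `T = diag(-2 d fᵢ)` is `isUnit_det_lineGram_of_nondegenerate` (`Prop311PrintedL2Model`).  Hence:

* **`prop311_L2_holds`** — for EVERY quadratic extension of number fields `E/F` (`σ`, `δ` with `σ δ = -δ ≠ 0`, `δ² = d`),
  every skew-Hermitian `(V, Φ)` with a `Φ`-orthogonal `E`-basis `b`, `Φ(bᵢ, bᵢ) = fᵢ δ` (any signs, any signature at every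
  place), `φ = Tr Φ` non-degenerate, every line enumeration `e`, every Haar measure `ν` on `𝐀_Fⁿ`: THE rational splitting
  `i` of `π` over `Sp_F(W)` for `ρ = l2Model` exists uniquely, and clauses (1) ∧ (2) of Prop. 3.1.1 hold verbatim — "the
  covering `π` splits over `G(𝐀)`; there exists a continuous section `s : G(𝐀) → Mp_𝐀(W)` such that `s(G(F)) ⊆ i(Sp_F(W))`" —
  with NO binder left beyond the printed data, the Haar measure and the two continuity witnesses `hψc`, `hβc` of the model's
  definition.  At CM data this is own-crow's `prop311_CM_L2'` (`Prop311PrintedCML2AllSignatures`).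

`Prop311.prop311AsPrinted_holds` (`Prop311AsPrintedHolds`) is the same statement for EVERY irreducible unitary model `ρ`, the
model's irreducibility being among its binders; here the model is the explicit `L²` one and its irreducibility is the tree's
`irreducible_rep_comp_toCoordHeisenberg` (inside `prop311_L2_of_record`).  Nothing in this file is a claim of the manuscripts
adjudicated by the Hodge-CM cell; HC_CM is not touched.

## References
* [GelbartRogawski1991] S. Gelbart, J. Rogawski, Invent. Math. 105 (1991) 445–472, §3.1 p. 454 L17–42, Prop. 3.1.1
  p. 455 L1–2.
* [Weil1964] A. Weil, Acta Math. 111 (1964) 143–211, Chap. I n° 11–13, Chap. III n° 37–39.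
* [HewittRoss1979] E. Hewitt, K. A. Ross, *Abstract Harmonic Analysis I*, 2nd ed. (1979), Thm. 22.18.
-/

set_option autoImplicit false

noncomputable section

open NumberField MeasureTheory
open scoped TensorProduct Matrix Kronecker
open Literature.NumberTheory.Automorphic
open Literature.RepresentationTheory.HeisenbergGroup
open Literature.RepresentationTheory.Unitary
open Literature.NumberTheory.Weil1964

namespace Literature.NumberTheory.GelbartRogawski1991

namespace Prop311

open UnitaryDualPair

section Quadratic

variable (F : Type) [Field F] [NumberField F]
variable (E : Type) [Field E] [NumberField E] [Algebra F E] [Algebra.IsQuadraticExtension F E]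
variable (σ : E ≃ₐ[F] E) {δ : E} (hσδ : σ δ = -δ) (hδ : δ ≠ 0) {d : F} (hd : δ * δ = algebraMap F E d)
variable (V : Type) [AddCommGroup V] [Module F V] [Module E V] [IsScalarTower F E V]
variable {n : ℕ} (b : Module.Basis (Fin n) E V) (Φ : V →ₗ[F] V →ₗ[F] E) (f : Fin n → F)
variable (e : Fin n × Fin 1 ≃ Fin n) (he : ∀ k : Fin n, (e.symm k).1 = k)
variable (hΦ₁ : ∀ (a : E) (x y : V), Φ (a • x) y = a * Φ x y)
  (hΦ₂ : ∀ (a : E) (x y : V), Φ x (a • y) = Φ x y * σ a)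
  (hb : ∀ i j, i ≠ j → Φ (b i) (b j) = 0)
  (hf : ∀ i, Φ (b i) (b i) = algebraMap F E (f i) * δ)
  (hφ : (traceForm F E V Φ).Nondegenerate)
variable [MeasurableSpace (AdeleRing (𝓞 F) F)] [BorelSpace (AdeleRing (𝓞 F) F)]
  (ν : Measure (Fin n → AdeleRing (𝓞 F) F)) [ν.IsAddHaarMeasure]
  (hψc : Continuous (adeleAddChar F : AdeleRing (𝓞 F) F → Circle))
  (hβc : ∀ y : Fin n → AdeleRing (𝓞 F) F,
    Continuous fun u : Fin n → AdeleRing (𝓞 F) F => adelicForm F (Fin n) (1 : Matrix (Fin n) (Fin n) (AdeleRing (𝓞 F) F)) u y)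

include he in
/-- **[GelbartRogawski1991, Prop. 3.1.1] AS PRINTED FOR THE `L²(𝐀_Fⁿ)` MODEL over an ARBITRARY quadratic `E/F` —
UNCONDITIONAL, every signature.**  For every quadratic extension `E/F` of number fields, every skew-Hermitian `(V, Φ)` with a
`Φ`-orthogonal basis `b`, `Φ(bᵢ, bᵢ) = fᵢ δ`, `Tr Φ` non-degenerate, every line enumeration `e` and every Haar measure `ν`:
THE rational splitting `i` of `π` over `Sp_F(W)` for `ρ = l2Model` (exists uniquely) and clauses (1) ∧ (2) of Prop. 3.1.1
verbatim.  Proof: GR-1's `prop311_L2_of_record` with its two inputs discharged — `hT := isUnit_det_lineGram_of_nondegenerate`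
and the record `hrec := compatibleSplitting_pairLineDatum` (the general doubling construction, `Prop311RecordShapesHold`).
[cite: GelbartRogawski1991, §3.1 p. 454 L17–42; Prop. 3.1.1 p. 455 L1–2; Weil1964, Chap. I n° 11–13, Chap. III n° 37–39]
[cite: HewittRoss1979, Thm. 22.18] -/
theorem prop311_L2_holds (hΦ₃ : ∀ x y : V, Φ y x = -σ (Φ x y)) :
    ∃ i : ratSp F E V Φ →* adelicMp F E V Φ (l2Model F E σ hσδ hδ hd V b Φ f e he hΦ₁ hΦ₂ hb hf hφ ν hψc hβc),
      IsRationalSplitting F E V Φ _ i ∧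
      (∀ i' : ratSp F E V Φ →* adelicMp F E V Φ (l2Model F E σ hσδ hδ hd V b Φ f e he hΦ₁ hΦ₂ hb hf hφ ν hψc hβc),
        IsRationalSplitting F E V Φ _ i' → i' = i) ∧
      (∃ s : adelicUnitary F E V Φ →* adelicMp F E V Φ (l2Model F E σ hσδ hδ hd V b Φ f e he hΦ₁ hΦ₂ hb hf hφ ν hψc hβc),
          ∀ g : adelicUnitary F E V Φ,
            projEnd F E V Φ _ (s g) =
              ((g : AdelicSpace F V ≃ₗ[AdeleRing (𝓞 F) F] AdelicSpace F V) :
                AdelicSpace F V →ₗ[AdeleRing (𝓞 F) F] AdelicSpace F V)) ∧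
        ∃ s : adelicUnitary F E V Φ →* adelicMp F E V Φ (l2Model F E σ hσδ hδ hd V b Φ f e he hΦ₁ hΦ₂ hb hf hφ ν hψc hβc),
          Continuous s ∧
          (∀ g : adelicUnitary F E V Φ,
            projEnd F E V Φ _ (s g) =
              ((g : AdelicSpace F V ≃ₗ[AdeleRing (𝓞 F) F] AdelicSpace F V) :
                AdelicSpace F V →ₗ[AdeleRing (𝓞 F) F] AdelicSpace F V)) ∧
          ∀ g : adelicUnitary F E V Φ,
            IsRationalPoint F E V Φ (g : AdelicSpace F V ≃ₗ[AdeleRing (𝓞 F) F] AdelicSpace F V) → s g ∈ i.range :=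
  prop311_L2_of_record F E σ hσδ hδ hd V b Φ f e he hΦ₁ hΦ₂ hb hf hφ ν hψc hβc hΦ₃
    (isUnit_det_lineGram_of_nondegenerate F E σ hδ hd V b Φ f hΦ₁ hΦ₂ hb hf hφ)
    (compatibleSplitting_pairLineDatum F E σ hσδ hδ hd f e
      (isUnit_det_lineGram_of_nondegenerate F E σ hδ hd V b Φ f hΦ₁ hΦ₂ hb hf hφ))

end Quadratic

end Prop311

end Literature.NumberTheory.GelbartRogawski1991

end
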